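import Mathlib
import Summits.PneNP.PneNP.Theorems.ConvexRankGatesConvexGateBlindVertices

/-!
# PneNP / ConvexRankGates — `ConvexGateBlind`: vertices of a cell, counted by dimension

Helpers (`--supports stmt-PneNP-10680`) for the SDP (small PSD block) corner of the crux. A **cell** is a
polytope `{u ∈ ℝ^p | u ≥ 0, u = 0 off S, c_j · u ≥ 0 (j ∈ J), ∑ u = 1}` with a prescribed support
`S ⊆ Fin p` and finitely many homogeneous constraints; it is convex and compact, its extreme points
admit no perturbation direction (`eq_zero_of_mem_extremePoints_cell`, as for the certificate polytope of
`ConvexRankGatesConvexGateBlindVertices.lean`), and — the point of this file — it has at most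
`(#S + |J| + 2)^{#S}` extreme points (`ncard_extremePoints_cell_le`), a bound exponential in the DIMENSION
`#S` of the cell and only polynomial in the number `|J|` of constraints: the tight forms at an extreme
point span `(ℝ^p)*`; extend the always-tight, linearly independent coordinate forms `{e_i : i ∉ S}` to
a basis inside the tight forms (`exists_linearIndepOn_id_extension`); the at most `#S` added forms come
from `{e_i : i ∈ S} ∪ {c_j} ∪ {𝟙}` and still pin the extreme point down. [folklore: basic solutions of
linear programmes; Schrijver, *Theory of Linear and Integer Programming*, §8]
-/

namespace Summit.PneNP.PneNP.Theorems

open Matrix Finset Filter Topology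

/-! ### Cells: polytopes with a prescribed support and finitely many homogeneous constraints -/

section cells

variable {p : ℕ} {J : Type*} [Fintype J]

omit [Fintype J] in
/-- A cell is convex. [folklore] -/
theorem convex_cell (S : Finset (Fin p)) (c : J → Fin p → ℝ) :
    Convex ℝ {u : Fin p → ℝ | (∀ i, 0 ≤ u i) ∧ (∀ i, i ∉ S → u i = 0) ∧ (∀ j, 0 ≤ c j ⬝ᵥ u) ∧
      ∑ i, u i = 1} := by
  intro u hu v hv a e ha he hae
  obtain ⟨hu1, hu2, hu3, hu4⟩ := hu
  obtain ⟨hv1, hv2, hv3, hv4⟩ := hv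
  refine ⟨fun i => ?_, fun i hi => ?_, fun j => ?_, ?_⟩
  · simp only [Pi.add_apply, Pi.smul_apply, smul_eq_mul]
    exact add_nonneg (mul_nonneg ha (hu1 i)) (mul_nonneg he (hv1 i))
  · simp [hu2 i hi, hv2 i hi]
  · rw [dotProduct_add, dotProduct_smul, dotProduct_smul, smul_eq_mul, smul_eq_mul]
    exact add_nonneg (mul_nonneg ha (hu3 j)) (mul_nonneg he (hv3 j))
  · have h : ∑ i, (a • u + e • v) i = a * ∑ i, u i + e * ∑ i, v i := by
      simp only [Pi.add_apply, Pi.smul_apply, smul_eq_mul, Finset.mul_sum, ← Finset.sum_add_distrib]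
    rw [h, hu4, hv4, mul_one, mul_one, hae]

omit [Fintype J] in
/-- A cell is compact (closed, inside the unit cube). [folklore] -/
theorem isCompact_cell (S : Finset (Fin p)) (c : J → Fin p → ℝ) :
    IsCompact {u : Fin p → ℝ | (∀ i, 0 ≤ u i) ∧ (∀ i, i ∉ S → u i = 0) ∧ (∀ j, 0 ≤ c j ⬝ᵥ u) ∧
      ∑ i, u i = 1} := by
  have hbox : IsCompact (Set.pi Set.univ fun _ : Fin p => Set.Icc (0 : ℝ) 1) :=
    isCompact_univ_pi fun _ => isCompact_Icc
  refine hbox.of_isClosed_subset ?_ ?_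
  · have h1 : IsClosed {u : Fin p → ℝ | ∀ i, 0 ≤ u i} := by
      rw [Set.setOf_forall]
      exact isClosed_iInter fun i => isClosed_le continuous_const (continuous_apply i)
    have h2 : IsClosed {u : Fin p → ℝ | ∀ i, i ∉ S → u i = 0} := by
      rw [Set.setOf_forall]
      refine isClosed_iInter fun i => ?_
      by_cases hi : i ∈ S
      · have : {u : Fin p → ℝ | i ∉ S → u i = 0} = Set.univ := Set.eq_univ_of_forall fun u h => (h hi).elim
        rw [this]; exact isClosed_univ
      · have : {u : Fin p → ℝ | i ∉ S → u i = 0} = {u | u i = 0} := by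
          ext u; simp [hi]
        rw [this]; exact isClosed_eq (continuous_apply i) continuous_const
    have h3 : IsClosed {u : Fin p → ℝ | ∀ j, 0 ≤ c j ⬝ᵥ u} := by
      rw [Set.setOf_forall]
      refine isClosed_iInter fun j => isClosed_le continuous_const ?_
      unfold dotProduct
      fun_prop
    have h4 : IsClosed {u : Fin p → ℝ | ∑ i, u i = 1} := isClosed_eq (by fun_prop) continuous_const
    simpa only [Set.setOf_and] using h1.inter (h2.inter (h3.inter h4))
  · rintro u ⟨hu1, -, -, hu4⟩
    simp only [Set.mem_pi, Set.mem_univ, Set.mem_Icc, forall_true_left]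
    intro i
    refine ⟨hu1 i, ?_⟩
    calc u i ≤ ∑ i, u i := Finset.single_le_sum (fun i _ => hu1 i) (Finset.mem_univ i)
      _ = 1 := hu4

/-- **Perturbation inside a cell.** If `d` vanishes wherever `u` does, is orthogonal to the constraints
tight at `u` and has coordinate sum `0`, then `u ± ε d` lie in the cell for some `ε > 0`. [folklore] -/
theorem exists_perturb_mem_cell (S : Finset (Fin p)) (c : J → Fin p → ℝ) {u d : Fin p → ℝ}
    (hu : u ∈ {u : Fin p → ℝ | (∀ i, 0 ≤ u i) ∧ (∀ i, i ∉ S → u i = 0) ∧ (∀ j, 0 ≤ c j ⬝ᵥ u) ∧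
      ∑ i, u i = 1})
    (hd1 : ∀ i, u i = 0 → d i = 0) (hd2 : ∀ j, c j ⬝ᵥ u = 0 → c j ⬝ᵥ d = 0) (hd3 : ∑ i, d i = 0) :
    ∃ ε : ℝ, 0 < ε ∧
      (u + ε • d) ∈ {u : Fin p → ℝ | (∀ i, 0 ≤ u i) ∧ (∀ i, i ∉ S → u i = 0) ∧
        (∀ j, 0 ≤ c j ⬝ᵥ u) ∧ ∑ i, u i = 1} ∧
      (u - ε • d) ∈ {u : Fin p → ℝ | (∀ i, 0 ≤ u i) ∧ (∀ i, i ∉ S → u i = 0) ∧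
        (∀ j, 0 ≤ c j ⬝ᵥ u) ∧ ∑ i, u i = 1} := by
  obtain ⟨hu1, hu2, hu3, hu4⟩ := hu
  have hev : ∀ᶠ t : ℝ in 𝓝 0, (u + t • d) ∈ {u : Fin p → ℝ | (∀ i, 0 ≤ u i) ∧
      (∀ i, i ∉ S → u i = 0) ∧ (∀ j, 0 ≤ c j ⬝ᵥ u) ∧ ∑ i, u i = 1} := by
    have h1 : ∀ i, ∀ᶠ t : ℝ in 𝓝 0, 0 ≤ u i + t * d i := by
      intro i
      rcases (hu1 i).eq_or_lt with h | h
      · have hdi : d i = 0 := hd1 i h.symm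
        exact Filter.Eventually.of_forall fun t => by rw [hdi, mul_zero, add_zero]; exact hu1 i
      · have ht : Tendsto (fun t : ℝ => u i + t * d i) (𝓝 0) (𝓝 (u i + 0 * d i)) :=
          ((continuous_const.add (continuous_id.mul continuous_const)).tendsto 0)
        rw [zero_mul, add_zero] at ht
        exact (ht.eventually_const_lt h).mono fun t ht => ht.le
    have h2 : ∀ j, ∀ᶠ t : ℝ in 𝓝 0, 0 ≤ c j ⬝ᵥ u + t * (c j ⬝ᵥ d) := by
      intro j
      rcases (hu3 j).eq_or_lt with h | h
      · have hdj : c j ⬝ᵥ d = 0 := hd2 j h.symm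
        exact Filter.Eventually.of_forall fun t => by rw [hdj, mul_zero, add_zero]; exact hu3 j
      · have ht : Tendsto (fun t : ℝ => c j ⬝ᵥ u + t * (c j ⬝ᵥ d)) (𝓝 0)
            (𝓝 (c j ⬝ᵥ u + 0 * (c j ⬝ᵥ d))) :=
          ((continuous_const.add (continuous_id.mul continuous_const)).tendsto 0)
        rw [zero_mul, add_zero] at ht
        exact (ht.eventually_const_lt h).mono fun t ht => ht.le
    filter_upwards [Filter.eventually_all.2 h1, Filter.eventually_all.2 h2] with t ht1 ht2
    refine ⟨fun i => by simpa using ht1 i, fun i hi => ?_, fun j => ?_, ?_⟩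
    · simp [hu2 i hi, hd1 i (hu2 i hi)]
    · rw [dotProduct_add, dotProduct_smul, smul_eq_mul]
      exact ht2 j
    · have h : ∑ i, (u + t • d) i = ∑ i, u i + t * ∑ i, d i := by
        simp only [Pi.add_apply, Pi.smul_apply, smul_eq_mul, Finset.mul_sum,
          ← Finset.sum_add_distrib]
      rw [h, hu4, hd3, mul_zero, add_zero]
  have hneg : Tendsto (fun t : ℝ => -t) (𝓝 0) (𝓝 0) := by
    simpa using (continuous_neg : Continuous fun t : ℝ => -t).tendsto 0
  have hev' := hneg.eventually hev
  obtain ⟨ε, hε, hall⟩ := Metric.eventually_nhds_iff.1 (hev.and hev')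
  have hdist : dist (ε / 2) 0 < ε := by
    rw [Real.dist_eq, sub_zero, abs_of_pos (half_pos hε)]
    exact half_lt_self hε
  obtain ⟨hplus, hminus⟩ := hall hdist
  refine ⟨ε / 2, half_pos hε, hplus, ?_⟩
  have h : u - (ε / 2) • d = u + (-(ε / 2)) • d := by rw [neg_smul, sub_eq_add_neg]
  rw [h]
  exact hminus

/-- **Extreme points of a cell admit no perturbation direction.** [folklore] -/
theorem eq_zero_of_mem_extremePoints_cell (S : Finset (Fin p)) (c : J → Fin p → ℝ) {u d : Fin p → ℝ}
    (hu : u ∈ {u : Fin p → ℝ | (∀ i, 0 ≤ u i) ∧ (∀ i, i ∉ S → u i = 0) ∧ (∀ j, 0 ≤ c j ⬝ᵥ u) ∧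
      ∑ i, u i = 1}.extremePoints ℝ)
    (hd1 : ∀ i, u i = 0 → d i = 0) (hd2 : ∀ j, c j ⬝ᵥ u = 0 → c j ⬝ᵥ d = 0) (hd3 : ∑ i, d i = 0) :
    d = 0 := by
  by_contra hd
  obtain ⟨ε, hε, hplus, hminus⟩ := exists_perturb_mem_cell S c hu.1 hd1 hd2 hd3
  have hseg : u ∈ openSegment ℝ (u - ε • d) (u + ε • d) := by
    refine ⟨1 / 2, 1 / 2, by norm_num, by norm_num, by norm_num, ?_⟩
    ext i
    simp only [Pi.add_apply, Pi.smul_apply, Pi.sub_apply, smul_eq_mul]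
    ring
  have h := hu.2 hminus hplus hseg
  have h' : ε • d = 0 := by
    have := congrArg (fun w => u - w) h
    simpa using this
  rcases smul_eq_zero.1 h' with h0 | h0
  · exact absurd h0 hε.ne'
  · exact hd h0

/-- The subsets of a finset `Z` of size at most `n` number at most `(#Z + 1)^n`. [folklore] -/
theorem card_filter_powerset_card_le {α : Type*} [DecidableEq α] (Z : Finset α) (n : ℕ) :
    (Z.powerset.filter fun T => T.card ≤ n).card ≤ (Z.card + 1) ^ n := by
  have hsub : (Z.powerset.filter fun T => T.card ≤ n) ⊆
      (Finset.range (n + 1)).biUnion fun s => Z.powersetCard s := by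
    intro T hT
    simp only [Finset.mem_filter, Finset.mem_powerset] at hT
    simp only [Finset.mem_biUnion, Finset.mem_range, Finset.mem_powersetCard]
    exact ⟨T.card, by omega, hT.1, rfl⟩
  calc (Z.powerset.filter fun T => T.card ≤ n).card
      ≤ ((Finset.range (n + 1)).biUnion fun s => Z.powersetCard s).card := Finset.card_le_card hsub
    _ ≤ ∑ s ∈ Finset.range (n + 1), (Z.powersetCard s).card := Finset.card_biUnion_le
    _ = ∑ s ∈ Finset.range (n + 1), Z.card.choose s :=
        Finset.sum_congr rfl fun s _ => Finset.card_powersetCard _ _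
    _ ≤ (Z.card + 1) ^ n := sum_range_choose_le_pow Z.card n

/-- **Vertex count for a cell, exponential in its dimension only.** The cell
`{u ∈ ℝ^p | u ≥ 0, u = 0 off S, c_j · u ≥ 0 ∀ j, ∑ u = 1}` has finitely many extreme points, at most
`(#S + |J| + 2)^{#S}`: an extreme point `u` is determined by its tight constraints, which span `(ℝ^p)*`;
extending the always-tight, linearly independent coordinate forms `{e_i : i ∉ S}` to a basis inside the
tight forms uses at most `#S` further forms, drawn from `{e_i : i ∈ S} ∪ {c_j} ∪ {𝟙}`, and this set of
further forms still determines `u` among extreme points. [folklore] -/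
theorem ncard_extremePoints_cell_le (S : Finset (Fin p)) (c : J → Fin p → ℝ) :
    ({u : Fin p → ℝ | (∀ i, 0 ≤ u i) ∧ (∀ i, i ∉ S → u i = 0) ∧ (∀ j, 0 ≤ c j ⬝ᵥ u) ∧
        ∑ i, u i = 1}.extremePoints ℝ).Finite ∧
      ({u : Fin p → ℝ | (∀ i, 0 ≤ u i) ∧ (∀ i, i ∉ S → u i = 0) ∧ (∀ j, 0 ≤ c j ⬝ᵥ u) ∧
        ∑ i, u i = 1}.extremePoints ℝ).ncard ≤ (S.card + Fintype.card J + 2) ^ S.card := by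
  classical
  set E := {u : Fin p → ℝ | (∀ i, 0 ≤ u i) ∧ (∀ i, i ∉ S → u i = 0) ∧ (∀ j, 0 ≤ c j ⬝ᵥ u) ∧
    ∑ i, u i = 1}.extremePoints ℝ with hE
  -- the forms: coordinate forms, constraint forms, the all-ones form
  let e : Fin p → Fin p → ℝ := fun i => Pi.single i 1
  let one : Fin p → ℝ := fun _ => 1
  have he_dot : ∀ (i : Fin p) (v : Fin p → ℝ), e i ⬝ᵥ v = v i := fun i v => by
    simp [e, single_dotProduct]
  have hone_dot : ∀ v : Fin p → ℝ, one ⬝ᵥ v = ∑ i, v i := fun v => by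
    simp [one, dotProduct]
  -- the always-tight coordinate forms
  let F₀ : Set (Fin p → ℝ) := Set.range fun i : {i // i ∉ S} => e i.1
  have hF₀li : LinearIndepOn ℝ id F₀ := by
    have h := (Pi.linearIndependent_single_one (Fin p) ℝ).comp
      (fun i : {i // i ∉ S} => i.1) Subtype.val_injective
    exact h.linearIndepOn_id
  -- tight forms at `u`
  let Tight : (Fin p → ℝ) → Set (Fin p → ℝ) := fun u =>
    {f | (f ∈ Set.range e ∨ f ∈ Set.range c) ∧ f ⬝ᵥ u = 0} ∪ {one}
  have hF₀sub : ∀ u ∈ E, F₀ ⊆ Tight u := by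
    rintro u hu f ⟨i, rfl⟩
    refine Or.inl ⟨Or.inl ⟨i.1, rfl⟩, ?_⟩
    rw [he_dot]
    exact hu.1.2.1 i.1 i.2
  -- the kernel of the tight forms is trivial at an extreme point
  have hker : ∀ u ∈ E, ∀ d : Fin p → ℝ, (∀ f ∈ Tight u, f ⬝ᵥ d = 0) → d = 0 := by
    intro u hu d hd
    refine eq_zero_of_mem_extremePoints_cell S c hu (fun i hi => ?_) (fun j hj => ?_) ?_
    · have h := hd (e i) (Or.inl ⟨Or.inl ⟨i, rfl⟩, by rw [he_dot]; exact hi⟩)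
      rwa [he_dot] at h
    · exact hd (c j) (Or.inl ⟨Or.inr ⟨j, rfl⟩, hj⟩)
    · have h := hd one (Or.inr rfl)
      rwa [hone_dot] at h
  -- choose a basis of the tight forms extending `F₀`
  have hbasis : ∀ u, ∃ b : Set (Fin p → ℝ), u ∈ E →
      F₀ ⊆ b ∧ b ⊆ Tight u ∧ Tight u ⊆ Submodule.span ℝ b ∧ LinearIndepOn ℝ id b := by
    intro u
    by_cases hu : u ∈ E
    · obtain ⟨b, hbT, hF₀b, hTspan, hbli⟩ := exists_linearIndepOn_id_extension hF₀li (hF₀sub u hu)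
      exact ⟨b, fun _ => ⟨hF₀b, hbT, hTspan, hbli⟩⟩
    · exact ⟨∅, fun h => absurd h hu⟩
  choose basis hbasis using hbasis
  -- finiteness of everything in sight
  let Z : Finset (Fin p → ℝ) := (S.image e ∪ Finset.univ.image c) ∪ {one}
  let F₀f : Finset (Fin p → ℝ) := (Finset.univ.filter fun i => i ∉ S).image e
  have hF₀f : (F₀f : Set (Fin p → ℝ)) = F₀ := by
    ext f
    simp only [F₀f, F₀, Finset.coe_image, Finset.coe_filter, Finset.mem_univ, true_and, Set.mem_image,
      Set.mem_setOf_eq, Set.mem_range, Subtype.exists, exists_prop]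
  have hTight_sub : ∀ u, Tight u ⊆ (F₀f : Set (Fin p → ℝ)) ∪ (Z : Set (Fin p → ℝ)) := by
    intro u f hf
    rcases hf with ⟨hf, -⟩ | hf
    · rcases hf with ⟨i, rfl⟩ | ⟨j, rfl⟩
      · by_cases hi : i ∈ S
        · right
          exact Finset.mem_coe.2 (Finset.mem_union_left _
            (Finset.mem_union_left _ (Finset.mem_image_of_mem e hi)))
        · left
          exact Finset.mem_coe.2 (Finset.mem_image.2
            ⟨i, Finset.mem_filter.2 ⟨Finset.mem_univ _, hi⟩, rfl⟩)
      · right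
        exact Finset.mem_coe.2 (Finset.mem_union_left _
          (Finset.mem_union_right _ (Finset.mem_image_of_mem c (Finset.mem_univ j))))
    · right
      rw [Set.mem_singleton_iff.1 hf]
      exact Finset.mem_coe.2 (Finset.mem_union_right _ (Finset.mem_singleton_self _))
  have hbfin : ∀ u ∈ E, (basis u).Finite := fun u hu =>
    ((F₀f.finite_toSet.union Z.finite_toSet).subset (hTight_sub u)).subset (hbasis u hu).2.1
  -- the code of an extreme point: its basis forms outside `F₀`
  let code : (Fin p → ℝ) → Finset (Fin p → ℝ) := fun u =>
    if hu : u ∈ E then (hbfin u hu).toFinset \ F₀f else ∅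
  have hcode_sub : ∀ u ∈ E, code u ⊆ Z := by
    intro u hu f hf
    simp only [code, dif_pos hu, Finset.mem_sdiff, Set.Finite.mem_toFinset] at hf
    rcases hTight_sub u ((hbasis u hu).2.1 hf.1) with h | h
    · exact absurd h hf.2
    · exact h
  have hcode_card : ∀ u ∈ E, (code u).card ≤ S.card := by
    intro u hu
    obtain ⟨hF₀b, hbT, -, hbli⟩ := hbasis u hu
    have hcardb : (hbfin u hu).toFinset.card ≤ p := by
      haveI := (hbfin u hu).fintype
      have h := hbli.linearIndependent.fintype_card_le_finrank
      rw [Module.finrank_fintype_fun_eq_card, Fintype.card_fin] at h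
      rw [Set.Finite.card_toFinset]
      exact h
    have he_inj : Function.Injective e := by
      intro i j hij
      have h := congr_fun hij i
      by_contra hne
      simp [e, hne] at h
    have hF₀card : F₀f.card = p - S.card := by
      rw [Finset.card_image_of_injective _ he_inj, Finset.filter_not, Finset.filter_mem_eq_inter,
        Finset.univ_inter, Finset.card_univ_sdiff, Fintype.card_fin]
    have hsub : F₀f ⊆ (hbfin u hu).toFinset := by
      intro f hf
      rw [Set.Finite.mem_toFinset]
      exact hF₀b (by rw [← hF₀f]; exact hf)
    simp only [code, dif_pos hu]
    rw [Finset.card_sdiff_of_subset hsub]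
    have hS : S.card ≤ p := by
      calc S.card ≤ (Finset.univ : Finset (Fin p)).card := Finset.card_le_univ S
        _ = p := by simp
    omega
  -- the code is injective on extreme points
  have hinj : Set.InjOn code E := by
    intro u hu u' hu' hcode
    have hd : u - u' = 0 := by
      refine hker u hu (u - u') fun f hf => ?_
      -- `f` tight at `u` lies in the span of `basis u`; forms of `basis u` kill `u - u'`
      have hkill : ∀ g ∈ basis u, g ⬝ᵥ (u - u') = 0 := by
        intro g hg
        by_cases hg0 : g ∈ F₀
        · obtain ⟨i, rfl⟩ := hg0
          rw [he_dot, Pi.sub_apply, hu.1.2.1 i.1 i.2, hu'.1.2.1 i.1 i.2, sub_zero]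
        · -- `g` is in the code of `u`, hence of `u'`, hence tight at both
          have hgc : g ∈ code u := by
            simp only [code, dif_pos hu, Finset.mem_sdiff, Set.Finite.mem_toFinset]
            exact ⟨hg, fun h => hg0 (by rw [← hF₀f]; exact h)⟩
          have hgc' : g ∈ code u' := hcode ▸ hgc
          simp only [code, dif_pos hu', Finset.mem_sdiff, Set.Finite.mem_toFinset] at hgc'
          have hgT : g ∈ Tight u := (hbasis u hu).2.1 hg
          have hgT' : g ∈ Tight u' := (hbasis u' hu').2.1 hgc'.1
          rcases hgT with ⟨-, hg1⟩ | hg1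
          · rcases hgT' with ⟨-, hg2⟩ | hg2
            · rw [dotProduct_sub, hg1, hg2, sub_zero]
            · rw [Set.mem_singleton_iff.1 hg2, dotProduct_sub, hone_dot, hone_dot, hu.1.2.2.2,
                hu'.1.2.2.2, sub_self]
          · rw [Set.mem_singleton_iff.1 hg1, dotProduct_sub, hone_dot, hone_dot, hu.1.2.2.2,
              hu'.1.2.2.2, sub_self]
      have hspan : f ∈ Submodule.span ℝ (basis u) := (hbasis u hu).2.2.1 hf
      refine Submodule.span_induction (p := fun g _ => g ⬝ᵥ (u - u') = 0) hkill ?_ ?_ ?_ hspan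
      · exact zero_dotProduct _
      · intro g g' _ _ hg hg'
        rw [add_dotProduct, hg, hg', add_zero]
      · intro a g _ hg
        rw [smul_dotProduct, hg, smul_zero]
    exact sub_eq_zero.1 hd
  -- count
  let F : Finset (Finset (Fin p → ℝ)) := Z.powerset.filter fun T => T.card ≤ S.card
  have hmaps : ∀ u ∈ E, code u ∈ (F : Set (Finset (Fin p → ℝ))) := by
    intro u hu
    simp only [F, Finset.coe_filter, Set.mem_setOf_eq, Finset.mem_powerset]
    exact ⟨hcode_sub u hu, hcode_card u hu⟩
  have hFfin : (F : Set (Finset (Fin p → ℝ))).Finite := F.finite_toSet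
  have hfin : E.Finite :=
    Set.Finite.of_finite_image (hFfin.subset (Set.image_subset_iff.2 hmaps)) hinj
  refine ⟨hfin, ?_⟩
  have hZ : Z.card ≤ S.card + Fintype.card J + 1 := by
    calc Z.card ≤ (S.image e ∪ Finset.univ.image c).card + ({one} : Finset (Fin p → ℝ)).card :=
          Finset.card_union_le _ _
      _ ≤ (S.image e).card + (Finset.univ.image c).card + 1 :=
          Nat.add_le_add (Finset.card_union_le _ _) (by simp)
      _ ≤ S.card + Fintype.card J + 1 :=
          Nat.add_le_add_right (Nat.add_le_add Finset.card_image_le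
            (Finset.card_image_le.trans (by simp))) _
  calc E.ncard ≤ (F : Set (Finset (Fin p → ℝ))).ncard :=
        Set.ncard_le_ncard_of_injOn code hmaps hinj hFfin
    _ = F.card := Set.ncard_coe_finset F
    _ ≤ (Z.card + 1) ^ S.card := card_filter_powerset_card_le Z S.card
    _ ≤ (S.card + Fintype.card J + 2) ^ S.card := Nat.pow_le_pow_left (by omega) _

end cells

end Summit.PneNP.PneNP.Theorems
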